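import Summits.AtomisticToContinuum.FouriersLaw.Theses.PhononMeanFreePath
import Summits.AtomisticToContinuum.FouriersLaw.Theorems.BoundaryKubo.Negative.LoadBearing
import Summits.AtomisticToContinuum.FouriersLaw.Theorems.PhononMeanFreePathBoundaryKuboEnergyBalance
import Summits.AtomisticToContinuum.FouriersLaw.Theorems.PhononMeanFreePathBoundaryKuboGibbsTTCF
import Summits.AtomisticToContinuum.FouriersLaw.Theorems.PhononMeanFreePathBoundaryKuboKernelContinuity
import Summits.AtomisticToContinuum.FouriersLaw.Theorems.PhononMeanFreePathBoundaryKuboLimitExchange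
import Summits.AtomisticToContinuum.FouriersLaw.Theorems.PhononMeanFreePathBoundaryKuboSumRule
import Summits.AtomisticToContinuum.FouriersLaw.Theorems.PhononMeanFreePathBoundaryKuboUniformHarris
import Summits.AtomisticToContinuum.FouriersLaw.Theorems.PhononMeanFreePathBoundaryKuboUniformLocalMinorization
import Summits.AtomisticToContinuum.FouriersLaw.Theorems.PhononMeanFreePathBoundaryKuboUniformBallGeHalf
import Summits.AtomisticToContinuum.FouriersLaw.Theorems.PhononMeanFreePathBoundaryKuboJointFeller
import Summits.AtomisticToContinuum.FouriersLaw.Theorems.PhononMeanFreePathBoundaryKuboUniformMinorization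

/-!
# Skeleton line `gibbs-ttcf` for crux `BoundaryKubo` (stmt-AtomisticToContinuum-11812)

(Lead's reshaped skeleton, 2026-08-16: `stub_uniformHarris` split into `stub_uniformMinorization` +
`stub_uniformHarris_of_minorization`; second reshape after wave 1 (6 stubs landed): `stub_uniformMinorization`
split into `stub_uniformLocalMinorization`, `stub_uniformBallGeHalf`, `stub_jointFeller`, `stub_uniformMinorization_of`
(lead); every registered stub stated over importable declarations only.)

Route `PhononMeanFreePath` (sub-problem `FouriersLaw`), crux r4 `BoundaryKubo` = the fixed-`N`
CROSS-FORM BOUNDARY KUBO IDENTITY: for `P = pinnedChain ω₂ lam β γ` (all four `> 0`), assuming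
weak-NESS uniqueness (`UniqueSteady`, = route item `NessUnique` at the point), for every steady
family `μ`, every `T > 0` and every `N` (chain of `N+1` sites `0..N`, `μ₀ = P.gibbsMeasure (N+1) T`,
`K_t = P.transitionKernel (N+1) T T t` the CONSTRUCTED equal-temperature kernels,
`C_N(t) = Y(t) := Cov_{μ₀}(p_0², K_t p_N²)` = `LoadBearing.kuboIntegrand`):
`C_N ∈ L¹(0,∞)` and `totalCurrent(μ (N+1) (T+δ/2) (T-δ/2))/δ → N·(γ²/T²)·∫₀^∞ C_N` (`δ → 0`, `δ ≠ 0`).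

## The line (crux idea card `Ideas/gibbs-ttcf.md`, ideator 1, triage r1: pass ×3)

GIBBS-TESTED TRANSIENT TIME-CORRELATION FORMULA. Put `δ` on the DYNAMICS and keep the MEASURE
explicit: with `K^δ_t := P.transitionKernel (N+1) (T+δ/2) (T-δ/2) t` and `L_δ = L₀ + δ(γ/2)(∂²_{p_0} - ∂²_{p_N})`,
one Gaussian integration by parts under the Gibbs density (`integral_generator_mul_gibbsDensity`)
gives `μ₀(L_δ f) = δ(γ/2T²)·μ₀((p_0² - p_N²) f)`, hence the EXACT finite-time identity
(Evans–Searles / Agarwal TTCF with the dissipation function of a temperature step in closed form)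

  `μ₀(K^δ_S p_N²) - μ₀(p_N²) = δ(γ/2T²) ∫₀^S μ₀((p_0² - p_N²)·K^δ_s p_N²) ds`     (`stub_gibbsTTCF`),

exact at every `δ` and `S` (checked to 9e-13 in the Gaussian closure by triage r1-1 kit j009520 C1,
analytically by r1-2/r1-3). Letting `S → ∞` by Harris AT `δ` (the steady state of the line is the
Harris invariant measure `ν_δ`, a weak steady state, `= μ (N+1) (T±δ/2)` by the crux's uniqueness)
and then `δ → 0` INSIDE the `s`-integral — pointwise by pathwise continuity of the constructed
kernels in the two noise amplitudes `√(2γT_b)` (`stub_kernelContinuity`), dominated thanks to Harris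
constants that are LOCALLY UNIFORM in the bath temperatures (`stub_uniformHarris`, the hardest stub)
— yields (`stub_limitExchange`) the response of the end kinetic temperature
  `(μ_δ(p_N²) - T)/δ → (γ/2T²)(∫Y - ∫X)`,  `X(t) := Cov_{μ₀}(p_N², K_t p_N²)` (`autoIntegrand`).
CLOSING: the energy balance `totalCurrent(μ_δ) = N·γ·(μ_δ(p_N²) - T_R)` (`stub_energyBalance`,
`L H_{>i} = j_i + γ(T_R - p_N²)` under a weak steady state with exponential moments) and the
equilibrium sum rule `∫X + ∫Y = T²/γ` (`stub_sumRule`, from `L₀H = γ(2T - p_0² - p_N²)`,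
`Cov_{μ₀}(H, p_N²) = T²` and equilibrium Harris) turn this into
`totalCurrent/δ → Nγ[(γ/2T²)(∫Y - ∫X) + ½] = N(γ²/T²)∫Y` — the crux's value — and the sum-rule stub
also delivers the integrability clause `Y = C_N ∈ L¹(Ioi 0)`.  `BoundaryKubo_of` composes the six
stubs into the crux BY NAME (kernel-checked, no `sorry`; the identification `μ_δ = ν_δ`, the
eventual energy balance on `𝓝[≠] 0` and the closing algebra are proved here).

## Disproof used (`Cruxes/BoundaryKubo/Disproof.lean`, cdisprove cycle 1; landed as
`Theorems/BoundaryKubo/Negative/LoadBearing.lean` p73600 — IMPORTED here — and `Negative/Reflection.lean` p73601)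

* `boundaryKubo_iff` (`Iff.rfl` read-back) is the first step of `BoundaryKubo_of`.
* `limitClause_false_without_steady` / `_T_pos`: honoured — the family enters ONLY through the
  identification `μ (N+1) (T+δ/2) (T-δ/2) = ν_δ` (uniqueness + `ν_δ` weak steady, in the glue and in
  `stub_limitExchange`), which needs `T ± δ/2 > 0` (`δ₀ < 2T` in `stub_uniformHarris`).
* `steadyFamily_apply_self`: at `δ = 0` the family member is the Gibbs state; used by the prover of
  `stub_limitExchange` (value `μ₀(p_N²) = T`).
* `boundaryKubo_iff_gamma_nonneg` / §5: `γ > 0` is used only through mixing (`stub_uniformHarris`,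
  `stub_sumRule`) — the finite-time identity `stub_gibbsTTCF` and `stub_energyBalance` hold for `γ ≥ 0`.
* §1 (`N = 0`): every stub is consistent at `N = 0` (one site, `p_0² - p_N² = 0`, `totalCurrent = 0`).
* §7: no pointwise positivity of `C_N` is used anywhere; Disproof item 2: `lam, β > 0` are not used by
  any identity (only by the existence theory behind the steady family).
* Reflection glue (§6) is NOT needed by this line (closing by energy balance + sum rule).
No landed Negative lemma refutes an instance of any stub (the two Negative files contain no
refutation of a fixed-`N` response statement; `ledger negatives`: 12 refuted, none on Langevin kernels).
-/

noncomputable section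

open scoped NNReal ENNReal Topology
open MeasureTheory Filter Set

namespace Summit.AtomisticToContinuum.FouriersLaw.Cruxes.BoundaryKubo.GibbsTtcf

open Literature.MathematicalPhysics.KineticTheory.HeatConduction
open Summit.AtomisticToContinuum.FouriersLaw.Theorems.BoundaryKubo.Negative.LoadBearing
  (kuboIntegrand kuboValue LimitClause UniqueSteady SteadyFamily boundaryKubo_iff)

/-! ### Vocabulary (the crux's own sub-terms; `kuboIntegrand` = `Y` is imported from `LoadBearing`) -/

/-- The end AUTOCORRELATION integrand `X(t) = μ₀(p_N² · K_t p_N²) - μ₀(p_N²)·μ₀(K_t p_N²)`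
(`= Cov_{μ₀}(p_N², K_t p_N²)`) of the `(N+1)`-site chain at temperature `T`, written exactly like
the crux's `kuboIntegrand` (`Y(t)`, first factor `p_0²`) with `p_N²` as first factor. [folklore] -/
def autoIntegrand (ω₂ lam β γ T : ℝ) (N : ℕ) (t : ℝ) : ℝ :=
  (∫ z, (z.2 (Fin.last N)) ^ 2 * (∫ y, (y.2 (Fin.last N)) ^ 2
      ∂((pinnedChain ω₂ lam β γ).transitionKernel (N + 1) T T t.toNNReal z))
      ∂((pinnedChain ω₂ lam β γ).gibbsMeasure (N + 1) T)) -
    (∫ z, (z.2 (Fin.last N)) ^ 2 ∂((pinnedChain ω₂ lam β γ).gibbsMeasure (N + 1) T)) *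
      (∫ z, (∫ y, (y.2 (Fin.last N)) ^ 2
        ∂((pinnedChain ω₂ lam β γ).transitionKernel (N + 1) T T t.toNNReal z))
        ∂((pinnedChain ω₂ lam β γ).gibbsMeasure (N + 1) T))

/-! ### The six statements of the line (named; each IS its registered stub, see `…_holds` below) -/

/-- STUB 1a statement — UNIFORM MINORISATION near the equilibrium point (rank 1, HARDEST): CEHR
Prop. 3.6 for the constructed kernels at bath temperatures `(T+δ/2, T-δ/2)` with a minorisation mass
uniform in `|δ| ≤ δ₀`. [cite: CuneoEckmannHairerReyBellet2018, Prop 3.6] -/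
def UniformMinorization : Prop :=
  ∀ ω₂ lam β γ : ℝ, 0 < ω₂ → 0 < lam → 0 < β → 0 < γ → ∀ (N : ℕ) (T : ℝ), 0 < T →
    ∃ δ₀ : ℝ, 0 < δ₀ ∧ δ₀ < 2 * T ∧
      ∀ C : Set (PhaseSpace (N + 1)), IsCompact C → ∃ t_C : ℝ≥0, ∀ t : ℝ≥0, t_C ≤ t →
        ∃ α : ℝ≥0∞, 0 < α ∧ ∀ δ : ℝ, |δ| ≤ δ₀ →
          ∃ ν : Measure (PhaseSpace (N + 1)), IsProbabilityMeasure ν ∧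
            ∀ z ∈ C, α • ν ≤
              (pinnedChain ω₂ lam β γ).transitionKernel (N + 1) (T + δ / 2) (T - δ / 2) t z

/-- STUB 1 statement — LOCALLY UNIFORM HARRIS near the equilibrium point (rank 2, HARDEST, size L).
For every `T > 0` and `N` there are `δ₀ ∈ (0, 2T)`, `θ ∈ (0, 1/T)`, `C, c > 0` such that for every
`|δ| ≤ δ₀` the constructed kernels `K^δ_t = transitionKernel (N+1) (T+δ/2) (T-δ/2) t` admit a weak
steady state `ν_δ` (`IsSteadyState`, so a probability measure) integrating `e^{θH}` with
`|K^δ_t f(z) - ν_δ(f)| ≤ C e^{θH(z)} e^{-ct}` for all `z`, `t` and all continuous `|f| ≤ e^{θH}` —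
i.e. CEHR 2018 Thm 2.13 (2.5) (`pinnedChainSemigroup_ergodic`, PROVED at each `(T_L,T_R)` with
`∃ C c`) with constants uniform on `|δ| ≤ δ₀`, plus `IsInvariant.isSteadyState`. [cite: CuneoEckmannHairerReyBellet2018, Thm 2.13] -/
def UniformHarris : Prop :=
  ∀ ω₂ lam β γ : ℝ, 0 < ω₂ → 0 < lam → 0 < β → 0 < γ → ∀ (N : ℕ) (T : ℝ), 0 < T →
    ∃ δ₀ θ C c : ℝ, 0 < δ₀ ∧ δ₀ < 2 * T ∧ 0 < θ ∧ θ * T < 1 ∧ 0 < C ∧ 0 < c ∧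
      ∀ δ : ℝ, |δ| ≤ δ₀ →
        ∃ ν : Measure (PhaseSpace (N + 1)),
          (pinnedChain ω₂ lam β γ).IsSteadyState (N + 1) (T + δ / 2) (T - δ / 2) ν ∧
          Integrable (fun z => Real.exp (θ * (pinnedChain ω₂ lam β γ).hamiltonian (N + 1) z)) ν ∧
          ∀ (z : PhaseSpace (N + 1)) (t : ℝ≥0) (f : PhaseSpace (N + 1) → ℝ), Continuous f →
            (∀ y, |f y| ≤ Real.exp (θ * (pinnedChain ω₂ lam β γ).hamiltonian (N + 1) y)) →
            |(∫ y, f y ∂((pinnedChain ω₂ lam β γ).transitionKernel (N + 1)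
                  (T + δ / 2) (T - δ / 2) t z)) - ∫ y, f y ∂ν| ≤
              C * Real.exp (θ * (pinnedChain ω₂ lam β γ).hamiltonian (N + 1) z) * Real.exp (-c * t)

/-- STUB 2 statement — the EXACT FINITE-TIME GIBBS-TESTED TTCF IDENTITY for the end kinetic
temperature (rank 3, size M/L; the card's First lemma, specialised to `A = p_N²`): for `|δ| < 2T`,
`S ≥ 0`, `μ₀(K^δ_S p_N²) - μ₀(p_N²) = δ(γ/2T²)∫₀^S μ₀((p_0² - p_N²)·K^δ_s p_N²) ds`. Both sides are
finite ((3.4): exponential moments along the kernels, Gibbs integrates `e^{θH}·poly` for `θ < 1/T`).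
Exact in the Gaussian closure (triage r1-1 C1, r1-2 A3, r1-3 by hand). [folklore] -/
def GibbsTTCF : Prop :=
  ∀ ω₂ lam β γ : ℝ, 0 < ω₂ → 0 < lam → 0 < β → 0 < γ → ∀ (N : ℕ) (T : ℝ), 0 < T →
    ∀ δ : ℝ, |δ| < 2 * T → ∀ S : ℝ, 0 ≤ S →
      (∫ z, (∫ y, (y.2 (Fin.last N)) ^ 2
          ∂((pinnedChain ω₂ lam β γ).transitionKernel (N + 1) (T + δ / 2) (T - δ / 2) S.toNNReal z))
          ∂((pinnedChain ω₂ lam β γ).gibbsMeasure (N + 1) T)) -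
        (∫ z, (z.2 (Fin.last N)) ^ 2 ∂((pinnedChain ω₂ lam β γ).gibbsMeasure (N + 1) T)) =
      δ * (γ / (2 * T ^ 2)) *
        ∫ s in (0 : ℝ)..S, ∫ z, ((z.2 0) ^ 2 - (z.2 (Fin.last N)) ^ 2) *
          (∫ y, (y.2 (Fin.last N)) ^ 2
            ∂((pinnedChain ω₂ lam β γ).transitionKernel (N + 1) (T + δ / 2) (T - δ / 2) s.toNNReal z))
          ∂((pinnedChain ω₂ lam β γ).gibbsMeasure (N + 1) T)

/-- STUB 3 statement — CONTINUITY OF THE CONSTRUCTED KERNELS IN THE BATH TEMPERATURES (rank 5, size M):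
for every continuous, polynomially bounded observable `f`, every `s ≥ 0` and every starting point `z`,
`(T_L, T_R) ↦ ∫ f d(transitionKernel (N+1) T_L T_R s z)` is continuous on `(0,∞)²`. The temperatures
enter `OscillatorChain.solMap` only through the two amplitudes `√(2γT_b)` multiplying the Brownian
pair (`chainNoise`); the pathwise flow is continuous in the noise path
(`pinnedChain_norm_chainFlow_sub_chainFlow_le`) and polynomial moments are uniformly integrable by
(3.4) (`lintegral_exp_mul_hamiltonian_pinnedChainSemigroup_le`). [folklore] -/
def KernelContinuity : Prop :=
  ∀ ω₂ lam β γ : ℝ, 0 < ω₂ → 0 < lam → 0 < β → 0 < γ → ∀ (N : ℕ) (s : ℝ≥0) (z : PhaseSpace (N + 1))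
    (f : PhaseSpace (N + 1) → ℝ), Continuous f →
    (∃ (C : ℝ) (k : ℕ), ∀ y, |f y| ≤ C * (1 + (pinnedChain ω₂ lam β γ).hamiltonian (N + 1) y) ^ k) →
    ContinuousOn (fun TT : ℝ × ℝ =>
        ∫ y, f y ∂((pinnedChain ω₂ lam β γ).transitionKernel (N + 1) TT.1 TT.2 s z))
      (Set.Ioi (0 : ℝ) ×ˢ Set.Ioi (0 : ℝ))

/-- STUB 4 conclusion — LINEAR RESPONSE OF THE END KINETIC TEMPERATURE along the crux's family
(the card's Transfer `C⁺` at `A = p_N²`): under weak-NESS uniqueness, for every steady family `μ`,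
`(μ_{(N+1),T+δ/2,T-δ/2}(p_N²) - T)/δ → (γ/2T²)(∫₀^∞ Y - ∫₀^∞ X)` as `δ → 0`, `δ ≠ 0`. [folklore] -/
def MomentumResponse : Prop :=
  ∀ ω₂ lam β γ : ℝ, 0 < ω₂ → 0 < lam → 0 < β → 0 < γ → UniqueSteady ω₂ lam β γ →
    ∀ μ : (M : ℕ) → ℝ → ℝ → Measure (PhaseSpace M), SteadyFamily ω₂ lam β γ μ →
      ∀ T : ℝ, 0 < T → ∀ N : ℕ,
        Tendsto (fun δ : ℝ =>
            ((∫ z, (z.2 (Fin.last N)) ^ 2 ∂(μ (N + 1) (T + δ / 2) (T - δ / 2))) - T) / δ)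
          (𝓝[≠] 0)
          (𝓝 (γ / (2 * T ^ 2) * ((∫ t in Ioi (0 : ℝ), kuboIntegrand ω₂ lam β γ T N t) -
            ∫ t in Ioi (0 : ℝ), autoIntegrand ω₂ lam β γ T N t)))

/-- STUB 5 statement — THE EQUILIBRIUM SUM RULE (rank 4, size M/L): `X, Y ∈ L¹(0,∞)` and
`∫₀^∞ X + ∫₀^∞ Y = T²/γ`. From `L₀H = γ(2T - p_0² - p_N²)` (bath part of the generator on `H`),
the Gibbs-adjoint / `Θ`-reversibility step `∫₀ᵗ μ₀((L₀H)·K_sĀ) ds = μ₀(H·K_tĀ) - μ₀(H·Ā)`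
(`Ā = p_N² - T`), `Cov_{μ₀}(H, p_N²) = T²` (Gaussian momenta) and equilibrium Harris
(`pinnedChainSemigroup_ergodic` at `(T,T)`: `μ₀(H·K_tĀ) → 0`, exponential decay of `X, Y`).
Exact in the Gaussian closure (triage r1-1 C2, r1-2 A1, r1-3 ep_check.py). [folklore] -/
def SumRule : Prop :=
  ∀ ω₂ lam β γ : ℝ, 0 < ω₂ → 0 < lam → 0 < β → 0 < γ → ∀ (N : ℕ) (T : ℝ), 0 < T →
    IntegrableOn (kuboIntegrand ω₂ lam β γ T N) (Ioi 0) ∧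
    IntegrableOn (autoIntegrand ω₂ lam β γ T N) (Ioi 0) ∧
    (∫ t in Ioi (0 : ℝ), autoIntegrand ω₂ lam β γ T N t) +
        (∫ t in Ioi (0 : ℝ), kuboIntegrand ω₂ lam β γ T N t) = T ^ 2 / γ

/-- STUB 6 statement — ENERGY BALANCE IN A WEAK STEADY STATE WITH EXPONENTIAL MOMENTS (rank 6,
size M): for the `(N+1)`-site chain between baths at `T_L, T_R > 0`, every weak steady state `ν`
(`IsSteadyState`: `∫ L f dν = 0` on `C_c^∞`) that integrates some `e^{θH}` has
`totalCurrent(ν) = N·γ·(ν(p_N²) - T_R)`: the local conservation law `L H_{>i} = j_i + γ(T_R - p_N²)`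
(`H_{>i}` = energy right of bond `i` with half of `V(q_{i+1}-q_i)`, sites `0..N`, `j_i` =
`bondCurrent`) tested against `ν` through smooth energy cut-offs (dominated by the moments); the last
index carries no bond (`bondCurrent = 0`). `N = 0`: both sides vanish. [folklore] -/
def EnergyBalance : Prop :=
  ∀ ω₂ lam β γ : ℝ, 0 < ω₂ → 0 < lam → 0 < β → 0 < γ → ∀ (N : ℕ) (T_L T_R : ℝ), 0 < T_L → 0 < T_R →
    ∀ ν : Measure (PhaseSpace (N + 1)),
      (pinnedChain ω₂ lam β γ).IsSteadyState (N + 1) T_L T_R ν →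
      (∃ θ : ℝ, 0 < θ ∧
        Integrable (fun z => Real.exp (θ * (pinnedChain ω₂ lam β γ).hamiltonian (N + 1) z)) ν) →
      (pinnedChain ω₂ lam β γ).totalCurrent ν =
        (N : ℝ) * γ * ((∫ z, (z.2 (Fin.last N)) ^ 2 ∂ν) - T_R)

/-! ### The registered stubs (`sorry` lives ONLY here)

Every stub is stated over existing, importable declarations only (`pinnedChain`, `transitionKernel`,
`gibbsMeasure`, `IsSteadyState`, `LoadBearing.kuboIntegrand/UniqueSteady/SteadyFamily`), so that a stub
prover can reproduce its signature verbatim in a `Theorems/` file with the imports of this skeleton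
(the named statements `UniformHarris`, … above are definitionally these, see `…_holds` below). -/

/-- STUB 1a-i (rank 1; size L) `stub_uniformLocalMinorization`: the LOCAL MINORISATION AT TIME ONE near the
equilibrium (`pinnedChain_minorization_at_one`, LangevinChainLocalMinorization.lean) with constants `(ε₁, r, c)`
UNIFORM for bath temperatures in a compact range `[Tlo, Thi] ⊂ (0,∞)`. Why plausibly true: the tree proof is a
submersion argument for the map (dyadic noise skeleton) ↦ (solution at time 1) through
`exists_measure_preimage_ge_of_surjective` (uniform in the parameter `(z, ρ)` = (initial condition, bridge
remainder)); the amplitudes `c_b = √(2γT_b)` enter the forcing `η = ρ + c_L·PL(x¹)e_0 + c_R·PL(x²)e_N` LINEARLY, so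
with the unit-amplitude skeleton solution `S₁` one has `Φ^{a,b}_1(z, PL x + r) = S₁(z, (c_L x¹, c_R x²), ρ_r)(1)`:
the SAME submersion `f` serves all temperatures, the law of the scaled skeleton `(c_L ξ¹, c_R ξ²)` dominates
`c₂/(c_L c_R)^{2^m}·Leb` on balls (Gaussian density, `exists_wienerPair_map_pairSkel_ge` + linear change of
variables), and the remainder `ρ_r = c_L r¹ e_0 + c_R r² e_N` is small on the good event uniformly for `c_b ≤ c_max`.
[cite: CuneoEckmannHairerReyBellet2018, Prop 3.6] -/
theorem stub_uniformLocalMinorization :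
    ∀ ω₂ lam β γ : ℝ, 0 < ω₂ → 0 < lam → 0 < β → 0 < γ → ∀ (N : ℕ) (Tlo Thi : ℝ), 0 < Tlo → Tlo ≤ Thi →
      ∃ ε₁ : ℝ, 0 < ε₁ ∧ ∃ r : ℝ, 0 < r ∧ ∃ c : ℝ≥0∞, 0 < c ∧
        ∀ a b : ℝ, Tlo ≤ a → a ≤ Thi → Tlo ≤ b → b ≤ Thi →
          ∀ z : PhaseSpace (N + 1), ‖z‖ < ε₁ →
            ∀ S ⊆ Metric.ball (0 : PhaseSpace (N + 1)) r, MeasurableSet S →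
              c * volume S ≤ (pinnedChain ω₂ lam β γ).transitionKernel (N + 1) a b 1 z S :=
  Summit.AtomisticToContinuum.FouriersLaw.Theorems.BoundaryKubo.GibbsTtcf.stub_uniformLocalMinorization

/-- STUB 1a-ii (size M) `stub_uniformBallGeHalf`: uniform stochastic continuity at the equilibrium
(`pinnedChain_transitionKernel_ball_ge_half`) with the short time `η` UNIFORM for temperatures in `(0, Thi]`:
the noise on `[0,s]` is `(c_L B¹, c_R B²)` with `c_b ≤ √(2γ Thi)`, so the tree proof goes through with
`|c_L|+|c_R|` replaced by its upper bound. [folklore] -/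
theorem stub_uniformBallGeHalf :
    ∀ ω₂ lam β γ : ℝ, 0 < ω₂ → 0 < lam → 0 < β → 0 < γ → ∀ (N : ℕ) (Thi : ℝ), 0 < Thi →
      ∀ ε₁ : ℝ, 0 < ε₁ → ∃ η : ℝ, 0 < η ∧ ∀ a b : ℝ, 0 < a → a ≤ Thi → 0 < b → b ≤ Thi →
        ∀ s : ℝ≥0, (s : ℝ) ≤ η → ∀ w : PhaseSpace (N + 1), ‖w‖ < ε₁ / 2 →
          2⁻¹ ≤ (pinnedChain ω₂ lam β γ).transitionKernel (N + 1) a b s w (Metric.ball 0 ε₁) :=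
  Summit.AtomisticToContinuum.FouriersLaw.Theorems.BoundaryKubo.GibbsTtcf.stub_uniformBallGeHalf

/-- STUB 1a-iii (size M) `stub_jointFeller`: the Feller property JOINTLY in (temperatures, initial condition):
for bounded continuous `g`, `(a, b, z) ↦ ∫ g dK^{a,b}_s(z)` is continuous on `(0,∞)² × X`. Pathwise the flow is
jointly continuous in (initial condition, forcing) (`pinnedChain_exists_norm_chainFlow_sub_lt`: continuity in the
forcing uniformly on energy sublevel sets, + `pinnedChain_continuous_solMap_left`), the forcing is continuous in the
amplitudes (`pinnedChain_continuous_solMap_temp`, landed with stub_kernelContinuity), and `g` is bounded: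
dominated convergence under `wienerPair`. [folklore] -/
theorem stub_jointFeller :
    ∀ ω₂ lam β γ : ℝ, 0 < ω₂ → 0 < lam → 0 < β → 0 < γ → ∀ (N : ℕ) (s : ℝ≥0)
      (g : PhaseSpace (N + 1) → ℝ), Continuous g → (∃ B : ℝ, ∀ y, |g y| ≤ B) →
      ContinuousOn (fun p : ℝ × ℝ × PhaseSpace (N + 1) =>
          ∫ y, g y ∂((pinnedChain ω₂ lam β γ).transitionKernel (N + 1) p.1 p.2.1 s p.2.2))
        (Set.Ioi (0 : ℝ) ×ˢ (Set.Ioi (0 : ℝ) ×ˢ (Set.univ : Set (PhaseSpace (N + 1))))) :=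
  Summit.AtomisticToContinuum.FouriersLaw.Theorems.BoundaryKubo.GibbsTtcf.stub_jointFeller

/-- STUB 1a-iv (rank 1 — lead) `stub_uniformMinorization_of`: the three inputs above give the uniform
minorisation `UniformMinorization` — the pointed small-set theorem
(`Literature.Probability.Process.MarkovSemigroup.exists_smul_le_of_isCompact_of_mem`, SmallSets.lean) re-run for
the FAMILY `K^δ`, `|δ| ≤ δ₀`: local small set `G₀ = B(0,ε₁/2)`, `ν₀ = c·Leb|_{B(0,r)}`, window `[1, 1+η]`
(Chapman–Kolmogorov of 1a-i with 1a-ii), whose base point `0` lies IN `G₀`, so the return step is the local small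
set itself; iteration over windows (`pow_le_apply_of_window`, `exists_nat_mul_le_le_mul`); a compact `C` (times the
compact temperature range) is covered by finitely many product opens on which `K^{a,b}_{s_i}(·, G₀) ≥ a_i > 0`
(pointwise reachability `pinnedChain_exists_transitionKernel_pos_of_zero_mem` + lower semicontinuity of
`(a,b,z) ↦ K^{a,b}_s(z, G₀)` from 1a-iii by portmanteau, pattern `eventually_lt_apply_of_isOpen`).
[cite: CuneoEckmannHairerReyBellet2018, Prop 3.6] -/
theorem stub_uniformMinorization_of :
    (∀ ω₂ lam β γ : ℝ, 0 < ω₂ → 0 < lam → 0 < β → 0 < γ → ∀ (N : ℕ) (Tlo Thi : ℝ), 0 < Tlo → Tlo ≤ Thi →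
      ∃ ε₁ : ℝ, 0 < ε₁ ∧ ∃ r : ℝ, 0 < r ∧ ∃ c : ℝ≥0∞, 0 < c ∧
        ∀ a b : ℝ, Tlo ≤ a → a ≤ Thi → Tlo ≤ b → b ≤ Thi →
          ∀ z : PhaseSpace (N + 1), ‖z‖ < ε₁ →
            ∀ S ⊆ Metric.ball (0 : PhaseSpace (N + 1)) r, MeasurableSet S →
              c * volume S ≤ (pinnedChain ω₂ lam β γ).transitionKernel (N + 1) a b 1 z S) →
    (∀ ω₂ lam β γ : ℝ, 0 < ω₂ → 0 < lam → 0 < β → 0 < γ → ∀ (N : ℕ) (Thi : ℝ), 0 < Thi →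
      ∀ ε₁ : ℝ, 0 < ε₁ → ∃ η : ℝ, 0 < η ∧ ∀ a b : ℝ, 0 < a → a ≤ Thi → 0 < b → b ≤ Thi →
        ∀ s : ℝ≥0, (s : ℝ) ≤ η → ∀ w : PhaseSpace (N + 1), ‖w‖ < ε₁ / 2 →
          2⁻¹ ≤ (pinnedChain ω₂ lam β γ).transitionKernel (N + 1) a b s w (Metric.ball 0 ε₁)) →
    (∀ ω₂ lam β γ : ℝ, 0 < ω₂ → 0 < lam → 0 < β → 0 < γ → ∀ (N : ℕ) (s : ℝ≥0)
      (g : PhaseSpace (N + 1) → ℝ), Continuous g → (∃ B : ℝ, ∀ y, |g y| ≤ B) →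
      ContinuousOn (fun p : ℝ × ℝ × PhaseSpace (N + 1) =>
          ∫ y, g y ∂((pinnedChain ω₂ lam β γ).transitionKernel (N + 1) p.1 p.2.1 s p.2.2))
        (Set.Ioi (0 : ℝ) ×ˢ (Set.Ioi (0 : ℝ) ×ˢ (Set.univ : Set (PhaseSpace (N + 1)))))) →
    ∀ ω₂ lam β γ : ℝ, 0 < ω₂ → 0 < lam → 0 < β → 0 < γ → ∀ (N : ℕ) (T : ℝ), 0 < T →
      ∃ δ₀ : ℝ, 0 < δ₀ ∧ δ₀ < 2 * T ∧
        ∀ C : Set (PhaseSpace (N + 1)), IsCompact C → ∃ t_C : ℝ≥0, ∀ t : ℝ≥0, t_C ≤ t →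
          ∃ α : ℝ≥0∞, 0 < α ∧ ∀ δ : ℝ, |δ| ≤ δ₀ →
            ∃ ν : Measure (PhaseSpace (N + 1)), IsProbabilityMeasure ν ∧
              ∀ z ∈ C, α • ν ≤
                (pinnedChain ω₂ lam β γ).transitionKernel (N + 1) (T + δ / 2) (T - δ / 2) t z :=
  Summit.AtomisticToContinuum.FouriersLaw.Theorems.BoundaryKubo.GibbsTtcf.stub_uniformMinorization_of

/-- STUB 1a (assembled): the uniform minorisation. -/
theorem stub_uniformMinorization :
    ∀ ω₂ lam β γ : ℝ, 0 < ω₂ → 0 < lam → 0 < β → 0 < γ → ∀ (N : ℕ) (T : ℝ), 0 < T →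
      ∃ δ₀ : ℝ, 0 < δ₀ ∧ δ₀ < 2 * T ∧
        ∀ C : Set (PhaseSpace (N + 1)), IsCompact C → ∃ t_C : ℝ≥0, ∀ t : ℝ≥0, t_C ≤ t →
          ∃ α : ℝ≥0∞, 0 < α ∧ ∀ δ : ℝ, |δ| ≤ δ₀ →
            ∃ ν : Measure (PhaseSpace (N + 1)), IsProbabilityMeasure ν ∧
              ∀ z ∈ C, α • ν ≤
                (pinnedChain ω₂ lam β γ).transitionKernel (N + 1) (T + δ / 2) (T - δ / 2) t z :=
  stub_uniformMinorization_of stub_uniformLocalMinorization stub_uniformBallGeHalf stub_jointFeller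

/-- STUB 1b (rank 2; size L) `stub_uniformHarris_of_minorization`: uniform minorisation ⇒ the locally
uniform Harris bound `UniformHarris` (CEHR (2.5) with `(θ, C, c)` uniform in `|δ| ≤ δ₀`). Why plausibly
true — it is a re-threading of EXPLICIT tree proofs: (i) H2 with uniform constants: the discharge
`CuneoEckmannHairerReyBellet2018_H2_holds` (LangevinChainH2Proof.lean) yields `κ = 1/2`, `K = {H ≤ E₁}`,
`c = e^{θγ(T_L+T_R)t*}e^{θE₁}` (`pinnedChain_H2_of_decay`, `pinnedChain_decay_of_window`,
`pinnedChain_window_decay_of_dissipation`) with `E₁ = K₅⁴`, `K₅` an explicit expression in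
`cs = |√(2γT_L)|+|√(2γT_R)|+1`, `G = e^{θγ(T_L+T_R)t*}` and `p = (1/(θ max T_b)+1)/2` — monotone in upper
bounds for the temperatures, hence uniform on `[T-δ₀/2, T+δ₀/2]`; (ii) (3.4)
`lintegral_exp_mul_hamiltonian_pinnedChainSemigroup_le` is explicit (`e^{θγ(T_L+T_R)t}`); (iii) Harris:
`Literature.Probability.Process.HarrisTheorem` (`contractionFactor` explicit in `(γ, K, α, R)`, independent of
the minorising measure; `abs_integral_sub_integral_le`, `abs_integral_pow_sub_integral_le`,
`lintegral_le_of_invariant`) and the model-free assembly `LangevinSemigroupHarris.lean`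
(`harris_of_H2_of_minorization`, `exp_convergence_of_H2_of_minorization`: skeleton `P_m`, `m ≥ t_C` integer,
`R = (2B+1)/(1-a)`, then `t = nm + r` with (3.4)); (iv) the steady state: `pinnedChainSemigroup_ergodic`
(invariant probability measure with all `e^{ϑH}` moments, per `δ`) + `pinnedChain_isSteadyState_of_isInvariant`.
No new mathematics; only the constants must be carried. [cite: CuneoEckmannHairerReyBellet2018, Thm 2.13 and Prop 3.8] -/
theorem stub_uniformHarris_of_minorization :
    (∀ ω₂ lam β γ : ℝ, 0 < ω₂ → 0 < lam → 0 < β → 0 < γ → ∀ (N : ℕ) (T : ℝ), 0 < T →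
      ∃ δ₀ : ℝ, 0 < δ₀ ∧ δ₀ < 2 * T ∧
        ∀ C : Set (PhaseSpace (N + 1)), IsCompact C → ∃ t_C : ℝ≥0, ∀ t : ℝ≥0, t_C ≤ t →
          ∃ α : ℝ≥0∞, 0 < α ∧ ∀ δ : ℝ, |δ| ≤ δ₀ →
            ∃ ν : Measure (PhaseSpace (N + 1)), IsProbabilityMeasure ν ∧
              ∀ z ∈ C, α • ν ≤
                (pinnedChain ω₂ lam β γ).transitionKernel (N + 1) (T + δ / 2) (T - δ / 2) t z) →
    (∀ ω₂ lam β γ : ℝ, 0 < ω₂ → 0 < lam → 0 < β → 0 < γ → ∀ (N : ℕ) (T : ℝ), 0 < T →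
      ∃ δ₀ θ C c : ℝ, 0 < δ₀ ∧ δ₀ < 2 * T ∧ 0 < θ ∧ θ * T < 1 ∧ 0 < C ∧ 0 < c ∧
        ∀ δ : ℝ, |δ| ≤ δ₀ →
          ∃ ν : Measure (PhaseSpace (N + 1)),
            (pinnedChain ω₂ lam β γ).IsSteadyState (N + 1) (T + δ / 2) (T - δ / 2) ν ∧
            Integrable (fun z => Real.exp (θ * (pinnedChain ω₂ lam β γ).hamiltonian (N + 1) z)) ν ∧
            ∀ (z : PhaseSpace (N + 1)) (t : ℝ≥0) (f : PhaseSpace (N + 1) → ℝ), Continuous f →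
              (∀ y, |f y| ≤ Real.exp (θ * (pinnedChain ω₂ lam β γ).hamiltonian (N + 1) y)) →
              |(∫ y, f y ∂((pinnedChain ω₂ lam β γ).transitionKernel (N + 1)
                    (T + δ / 2) (T - δ / 2) t z)) - ∫ y, f y ∂ν| ≤
                C * Real.exp (θ * (pinnedChain ω₂ lam β γ).hamiltonian (N + 1) z) * Real.exp (-c * t)) :=
  Summit.AtomisticToContinuum.FouriersLaw.Theorems.BoundaryKubo.GibbsTtcf.stub_uniformHarris_of_minorization

/-- STUB 2 (rank 3; size M/L) `stub_gibbsTTCF` = `GibbsTTCF`: the exact finite-time, finite-`δ`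
Gibbs-tested TTCF identity for `A = p_N²`. Recommended engine: LEBESGUE DUALITY of the Langevin kernels
(`OscillatorChain.IsConfining.integral_langevinKernel_duality` / `lintegral_langevinKernel_duality`,
`SubdiffusiveBondHeat.pinnedChain_isConfining`, `SubdiffusiveBondHeat.pinnedChain_langevinKernel_eq_transitionKernel`)
+ Dynkin for the reversed (anti-friction) kernels `langevinRevKernel` applied to the Gibbs density `ρ_T`
through energy cut-offs (template: `SubdiffusiveBondHeat.integral_gibbsDensity_langevinRevKernel`,
`revGenerator_gibbsDensity`, `doob_dynkin`): `L̂_δ ρ_T = (-2γ + δ(γ/2T²)(p_0²-p_N²)) ρ_T`, then the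
integrating factor `e^{2γs}`. `N = 0` (one site, both baths on it): both sides vanish consistently.
[cite: CuneoEckmannHairerReyBellet2018, §3.1] -/
theorem stub_gibbsTTCF :
    ∀ ω₂ lam β γ : ℝ, 0 < ω₂ → 0 < lam → 0 < β → 0 < γ → ∀ (N : ℕ) (T : ℝ), 0 < T →
      ∀ δ : ℝ, |δ| < 2 * T → ∀ S : ℝ, 0 ≤ S →
        (∫ z, (∫ y, (y.2 (Fin.last N)) ^ 2
            ∂((pinnedChain ω₂ lam β γ).transitionKernel (N + 1) (T + δ / 2) (T - δ / 2) S.toNNReal z))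
            ∂((pinnedChain ω₂ lam β γ).gibbsMeasure (N + 1) T)) -
          (∫ z, (z.2 (Fin.last N)) ^ 2 ∂((pinnedChain ω₂ lam β γ).gibbsMeasure (N + 1) T)) =
        δ * (γ / (2 * T ^ 2)) *
          ∫ s in (0 : ℝ)..S, ∫ z, ((z.2 0) ^ 2 - (z.2 (Fin.last N)) ^ 2) *
            (∫ y, (y.2 (Fin.last N)) ^ 2
              ∂((pinnedChain ω₂ lam β γ).transitionKernel (N + 1) (T + δ / 2) (T - δ / 2) s.toNNReal z))
            ∂((pinnedChain ω₂ lam β γ).gibbsMeasure (N + 1) T) :=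
  Summit.AtomisticToContinuum.FouriersLaw.Theorems.BoundaryKubo.GibbsTtcf.stub_gibbsTTCF

/-- STUB 3 (rank 5; size M) `stub_kernelContinuity` = `KernelContinuity`: joint continuity of
`(T_L,T_R) ↦ K^{T_L,T_R}_s f(z)` on `(0,∞)²` for continuous polynomially bounded `f`: the temperatures
enter `OscillatorChain.solMap` only through the amplitudes `√(2γT_b)` in `chainNoise` (linear); the flow is
continuous in the noise path (`pinnedChain_norm_chainFlow_sub_chainFlow_le`, LangevinChainNoiseContinuity /
FlowBounds: pathwise energy bounds in terms of the sup of the forcing); domination / uniform integrability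
from (3.4) `lintegral_exp_mul_hamiltonian_pinnedChainSemigroup_le` or the pathwise energy bound; then
`tendsto_integral_of_dominated_convergence` under `wienerPair` (`pinnedChain_integral_transitionKernel`). [folklore] -/
theorem stub_kernelContinuity :
    ∀ ω₂ lam β γ : ℝ, 0 < ω₂ → 0 < lam → 0 < β → 0 < γ → ∀ (N : ℕ) (s : ℝ≥0) (z : PhaseSpace (N + 1))
      (f : PhaseSpace (N + 1) → ℝ), Continuous f →
      (∃ (C : ℝ) (k : ℕ), ∀ y, |f y| ≤ C * (1 + (pinnedChain ω₂ lam β γ).hamiltonian (N + 1) y) ^ k) →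
      ContinuousOn (fun TT : ℝ × ℝ =>
          ∫ y, f y ∂((pinnedChain ω₂ lam β γ).transitionKernel (N + 1) TT.1 TT.2 s z))
        (Set.Ioi (0 : ℝ) ×ˢ Set.Ioi (0 : ℝ)) :=
  Summit.AtomisticToContinuum.FouriersLaw.Theorems.BoundaryKubo.GibbsTtcf.stub_kernelContinuity

/-- STUB 4 (rank 4; size M+) `stub_limitExchange`: uniform Harris → Gibbs TTCF → kernel continuity →
the response of the end kinetic temperature (`MomentumResponse`, written out). Pure measure theory:
identify `μ (N+1) (T+δ/2) (T-δ/2)` with the Harris steady state `ν_δ` (crux uniqueness; `ν_0 = Gibbs`,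
`steadyFamily_apply_self`); `S → ∞` in the TTCF identity by the uniform Harris bound after recentring
`μ₀((p_0²-p_N²)K^δ_s p_N²) = μ₀((p_0²-p_N²)(K^δ_s p_N² - ν_δ(p_N²)))` (`μ₀(p_0²) = μ₀(p_N²) = T`); `δ → 0`
inside by dominated convergence (pointwise: kernel continuity; domination `|p_0²-p_N²| C e^{θH} e^{-cs}`).
[folklore] -/
theorem stub_limitExchange :
    (∀ ω₂ lam β γ : ℝ, 0 < ω₂ → 0 < lam → 0 < β → 0 < γ → ∀ (N : ℕ) (T : ℝ), 0 < T →
      ∃ δ₀ θ C c : ℝ, 0 < δ₀ ∧ δ₀ < 2 * T ∧ 0 < θ ∧ θ * T < 1 ∧ 0 < C ∧ 0 < c ∧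
        ∀ δ : ℝ, |δ| ≤ δ₀ →
          ∃ ν : Measure (PhaseSpace (N + 1)),
            (pinnedChain ω₂ lam β γ).IsSteadyState (N + 1) (T + δ / 2) (T - δ / 2) ν ∧
            Integrable (fun z => Real.exp (θ * (pinnedChain ω₂ lam β γ).hamiltonian (N + 1) z)) ν ∧
            ∀ (z : PhaseSpace (N + 1)) (t : ℝ≥0) (f : PhaseSpace (N + 1) → ℝ), Continuous f →
              (∀ y, |f y| ≤ Real.exp (θ * (pinnedChain ω₂ lam β γ).hamiltonian (N + 1) y)) →
              |(∫ y, f y ∂((pinnedChain ω₂ lam β γ).transitionKernel (N + 1)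
                    (T + δ / 2) (T - δ / 2) t z)) - ∫ y, f y ∂ν| ≤
                C * Real.exp (θ * (pinnedChain ω₂ lam β γ).hamiltonian (N + 1) z) * Real.exp (-c * t)) →
    (∀ ω₂ lam β γ : ℝ, 0 < ω₂ → 0 < lam → 0 < β → 0 < γ → ∀ (N : ℕ) (T : ℝ), 0 < T →
      ∀ δ : ℝ, |δ| < 2 * T → ∀ S : ℝ, 0 ≤ S →
        (∫ z, (∫ y, (y.2 (Fin.last N)) ^ 2
            ∂((pinnedChain ω₂ lam β γ).transitionKernel (N + 1) (T + δ / 2) (T - δ / 2) S.toNNReal z))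
            ∂((pinnedChain ω₂ lam β γ).gibbsMeasure (N + 1) T)) -
          (∫ z, (z.2 (Fin.last N)) ^ 2 ∂((pinnedChain ω₂ lam β γ).gibbsMeasure (N + 1) T)) =
        δ * (γ / (2 * T ^ 2)) *
          ∫ s in (0 : ℝ)..S, ∫ z, ((z.2 0) ^ 2 - (z.2 (Fin.last N)) ^ 2) *
            (∫ y, (y.2 (Fin.last N)) ^ 2
              ∂((pinnedChain ω₂ lam β γ).transitionKernel (N + 1) (T + δ / 2) (T - δ / 2) s.toNNReal z))
            ∂((pinnedChain ω₂ lam β γ).gibbsMeasure (N + 1) T)) →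
    (∀ ω₂ lam β γ : ℝ, 0 < ω₂ → 0 < lam → 0 < β → 0 < γ → ∀ (N : ℕ) (s : ℝ≥0) (z : PhaseSpace (N + 1))
      (f : PhaseSpace (N + 1) → ℝ), Continuous f →
      (∃ (C : ℝ) (k : ℕ), ∀ y, |f y| ≤ C * (1 + (pinnedChain ω₂ lam β γ).hamiltonian (N + 1) y) ^ k) →
      ContinuousOn (fun TT : ℝ × ℝ =>
          ∫ y, f y ∂((pinnedChain ω₂ lam β γ).transitionKernel (N + 1) TT.1 TT.2 s z))
        (Set.Ioi (0 : ℝ) ×ˢ Set.Ioi (0 : ℝ))) →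
    (∀ ω₂ lam β γ : ℝ, 0 < ω₂ → 0 < lam → 0 < β → 0 < γ → UniqueSteady ω₂ lam β γ →
      ∀ μ : (M : ℕ) → ℝ → ℝ → Measure (PhaseSpace M), SteadyFamily ω₂ lam β γ μ →
        ∀ T : ℝ, 0 < T → ∀ N : ℕ,
          Tendsto (fun δ : ℝ =>
              ((∫ z, (z.2 (Fin.last N)) ^ 2 ∂(μ (N + 1) (T + δ / 2) (T - δ / 2))) - T) / δ)
            (𝓝[≠] 0)
            (𝓝 (γ / (2 * T ^ 2) * ((∫ t in Ioi (0 : ℝ), kuboIntegrand ω₂ lam β γ T N t) -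
              ∫ t in Ioi (0 : ℝ), ((∫ z, (z.2 (Fin.last N)) ^ 2 * (∫ y, (y.2 (Fin.last N)) ^ 2
              ∂((pinnedChain ω₂ lam β γ).transitionKernel (N + 1) T T t.toNNReal z))
              ∂((pinnedChain ω₂ lam β γ).gibbsMeasure (N + 1) T)) -
            (∫ z, (z.2 (Fin.last N)) ^ 2 ∂((pinnedChain ω₂ lam β γ).gibbsMeasure (N + 1) T)) *
              (∫ z, (∫ y, (y.2 (Fin.last N)) ^ 2
                ∂((pinnedChain ω₂ lam β γ).transitionKernel (N + 1) T T t.toNNReal z))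
                ∂((pinnedChain ω₂ lam β γ).gibbsMeasure (N + 1) T))))))) :=
  Summit.AtomisticToContinuum.FouriersLaw.Theorems.BoundaryKubo.GibbsTtcf.stub_limitExchange

/-- STUB 5 (rank 4; size M/L) `stub_sumRule` = `SumRule` (written out): `X, Y ∈ L¹(0,∞)` and
`∫₀^∞ X + ∫₀^∞ Y = T²/γ`. Engine WITHOUT kernel detailed balance (not in tree): Gibbs invariance of the
constructed kernels (`SubdiffusiveBondHeat.pinnedChain_gibbsMeasure_bind_transitionKernel`), decay to Gibbs
(`SubdiffusiveBondHeat.pinnedChain_exp_convergence_gibbs`; template `pinnedChain_kinCorr_exp_decay`,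
`pinnedChain_kinCorr_integrableOn`, `pinnedChain_measurable_kinCorr` for integrability/measurability of
`X, Y`), and the identity `μ₀(H·K_tA) - μ₀(H·A) = ∫₀ᵗ μ₀((L₀H)·K_sA) ds` (`A = p_N²`, `L₀H = γ(2T-p_0²-p_N²)`)
from the Lebesgue duality + the Doob–Dynkin identity of `SubdiffusiveBondHeat.doob_dynkin` extended from
`C²_c` to `f = H` by energy cut-offs (`revGenerator_gibbsDensity_mul_eq_flip` is pointwise for any `C²` f);
`t → ∞` by decay, `Cov_{μ₀}(H, p_N²) = T²` (Gaussian momenta). [folklore] -/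
theorem stub_sumRule :
    ∀ ω₂ lam β γ : ℝ, 0 < ω₂ → 0 < lam → 0 < β → 0 < γ → ∀ (N : ℕ) (T : ℝ), 0 < T →
      IntegrableOn (kuboIntegrand ω₂ lam β γ T N) (Ioi 0) ∧
      IntegrableOn (fun t : ℝ => ((∫ z, (z.2 (Fin.last N)) ^ 2 * (∫ y, (y.2 (Fin.last N)) ^ 2
              ∂((pinnedChain ω₂ lam β γ).transitionKernel (N + 1) T T t.toNNReal z))
              ∂((pinnedChain ω₂ lam β γ).gibbsMeasure (N + 1) T)) -
            (∫ z, (z.2 (Fin.last N)) ^ 2 ∂((pinnedChain ω₂ lam β γ).gibbsMeasure (N + 1) T)) *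
              (∫ z, (∫ y, (y.2 (Fin.last N)) ^ 2
                ∂((pinnedChain ω₂ lam β γ).transitionKernel (N + 1) T T t.toNNReal z))
                ∂((pinnedChain ω₂ lam β γ).gibbsMeasure (N + 1) T)))) (Ioi 0) ∧
      (∫ t in Ioi (0 : ℝ), ((∫ z, (z.2 (Fin.last N)) ^ 2 * (∫ y, (y.2 (Fin.last N)) ^ 2
              ∂((pinnedChain ω₂ lam β γ).transitionKernel (N + 1) T T t.toNNReal z))
              ∂((pinnedChain ω₂ lam β γ).gibbsMeasure (N + 1) T)) -
            (∫ z, (z.2 (Fin.last N)) ^ 2 ∂((pinnedChain ω₂ lam β γ).gibbsMeasure (N + 1) T)) *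
              (∫ z, (∫ y, (y.2 (Fin.last N)) ^ 2
                ∂((pinnedChain ω₂ lam β γ).transitionKernel (N + 1) T T t.toNNReal z))
                ∂((pinnedChain ω₂ lam β γ).gibbsMeasure (N + 1) T)))) +
          (∫ t in Ioi (0 : ℝ), kuboIntegrand ω₂ lam β γ T N t) = T ^ 2 / γ :=
  Summit.AtomisticToContinuum.FouriersLaw.Theorems.BoundaryKubo.GibbsTtcf.stub_sumRule

/-- STUB 6 (rank 6; size M) `stub_energyBalance` = `EnergyBalance`. Why plausibly true: it is the
stationarity of the energy to the right of each bond, `0 = ν(L H_{>i}) = ν(j_i) + γ(T_R - ν(p_N²))`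
(sign and factor checked by hand against `OscillatorChain.generator` / `bondCurrent`:
`X_H H_{>i} = -½V'(q_{i+1}-q_i)(p_i+p_{i+1}) = j_i`, bath part `γ(T_R∂²_{p_N} - p_N∂_{p_N})(p_N²/2) =
γ(T_R - p_N²)`), verified exactly in the Gaussian closure (triage r1-3: `J̃ = γ(⟨p_N²⟩ - T_R)` =
every mean bond current); the only work is testing the unbounded `H_{>i}` against a WEAK steady state:
`L(H_{>i}χ_R(H)) = χ_R L H_{>i} + H_{>i} Lχ_R + 2γT_R ∂_{p_N}H_{>i}∂_{p_N}χ_R`, all terms polynomial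
times functions supported in `{R ≤ H ≤ 2R}`, dominated by the exponential moment as `R → ∞`.
Leans on: `OscillatorChain.generator`, `OscillatorChain.bondCurrent`, `OscillatorChain.totalCurrent`,
`pinnedChain_deriv_V`, `partialP_hamiltonian`, `partialQ_hamiltonian_eq`, the cut-off functions of
`LangevinChainExpBound`, `IsSteadyState` (test functions `C_c^∞`). -/
theorem stub_energyBalance :
    ∀ ω₂ lam β γ : ℝ, 0 < ω₂ → 0 < lam → 0 < β → 0 < γ → ∀ (N : ℕ) (T_L T_R : ℝ), 0 < T_L → 0 < T_R →
    ∀ ν : Measure (PhaseSpace (N + 1)),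
      (pinnedChain ω₂ lam β γ).IsSteadyState (N + 1) T_L T_R ν →
      (∃ θ : ℝ, 0 < θ ∧
        Integrable (fun z => Real.exp (θ * (pinnedChain ω₂ lam β γ).hamiltonian (N + 1) z)) ν) →
      (pinnedChain ω₂ lam β γ).totalCurrent ν =
        (N : ℝ) * γ * ((∫ z, (z.2 (Fin.last N)) ^ 2 ∂ν) - T_R) :=
  Summit.AtomisticToContinuum.FouriersLaw.Theorems.BoundaryKubo.GibbsTtcf.stub_energyBalance

/-! ### Consistency: each named statement IS a registered stub or follows from them (definitionally) -/

theorem uniformHarris_holds : UniformHarris :=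
  stub_uniformHarris_of_minorization stub_uniformMinorization
theorem gibbsTTCF_holds : GibbsTTCF := stub_gibbsTTCF
theorem kernelContinuity_holds : KernelContinuity := stub_kernelContinuity
theorem momentumResponse_holds : MomentumResponse :=
  stub_limitExchange uniformHarris_holds stub_gibbsTTCF stub_kernelContinuity
theorem sumRule_holds : SumRule := stub_sumRule
theorem energyBalance_holds : EnergyBalance := stub_energyBalance

/-! ### The composition (PROVED): the named statements imply the crux, by name -/

/-- **`BoundaryKubo` from the stubs.** Read the crux back (`boundaryKubo_iff`); the integrability clause
is the sum rule; for the limit clause: `MomentumResponse` (fed by STUBS 1a, 1b, 2, 3 through STUB 4) gives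
the response of `μ_δ(p_N²)`; for `0 < |δ| ≤ δ₀` the family member IS the Harris steady state of
`UniformHarris` (crux uniqueness), which has an exponential moment, so `EnergyBalance` rewrites
`totalCurrent(μ_δ)/δ = Nγ·(μ_δ(p_N²) - T)/δ + Nγ/2` eventually along `𝓝[≠] 0`; the limit is
`Nγ[(γ/2T²)(∫Y - ∫X) + ½]`, which the sum rule turns into `N(γ²/T²)∫Y = kuboValue`. -/
theorem boundaryKubo_of_holds (h1 : UniformHarris) (h4 : MomentumResponse) (h5 : SumRule)
    (h6 : EnergyBalance) :
    Summit.AtomisticToContinuum.FouriersLaw.Theses.PhononMeanFreePath.BoundaryKubo := by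
  rw [boundaryKubo_iff]
  intro ω₂ lam β γ hω hl hβ hγ hU μ hμ T hT N
  obtain ⟨hY, hX, hsum⟩ := h5 ω₂ lam β γ hω hl hβ hγ N T hT
  refine ⟨hY, ?_⟩
  have hT0 : T ≠ 0 := hT.ne'
  have hγ0 : γ ≠ 0 := hγ.ne'
  -- the response of the end kinetic temperature
  have hresp := h4 ω₂ lam β γ hω hl hβ hγ hU μ hμ T hT N
  -- the window `|δ| ≤ δ₀` and the exponential moment of the steady states in it
  obtain ⟨δ₀, θ, C, c, hδ₀, hδ₀T, hθ, hθT, hC, hc, hH⟩ := h1 ω₂ lam β γ hω hl hβ hγ N T hT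
  set IY : ℝ := ∫ t in Ioi (0 : ℝ), kuboIntegrand ω₂ lam β γ T N t with hIY
  set IX : ℝ := ∫ t in Ioi (0 : ℝ), autoIntegrand ω₂ lam β γ T N t with hIX
  -- energy balance along the family, eventually: totalCurrent/δ = Nγ·(μ_δ(p_N²) - T)/δ + Nγ/2
  have hev : (fun δ : ℝ => (N : ℝ) * γ *
        (((∫ z, (z.2 (Fin.last N)) ^ 2 ∂(μ (N + 1) (T + δ / 2) (T - δ / 2))) - T) / δ) +
        (N : ℝ) * γ / 2) =ᶠ[𝓝[≠] (0 : ℝ)]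
      fun δ => (pinnedChain ω₂ lam β γ).totalCurrent (μ (N + 1) (T + δ / 2) (T - δ / 2)) / δ := by
    have hnhds : Icc (-δ₀) δ₀ ∈ 𝓝[≠] (0 : ℝ) :=
      mem_nhdsWithin_of_mem_nhds (Icc_mem_nhds (by linarith) hδ₀)
    filter_upwards [hnhds, self_mem_nhdsWithin] with δ hδ hne
    have hne' : δ ≠ 0 := Set.mem_compl_singleton_iff.mp hne
    have hδ' : |δ| ≤ δ₀ := abs_le.mpr ⟨hδ.1, hδ.2⟩
    have hL : 0 < T + δ / 2 := by linarith [hδ.1]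
    have hR : 0 < T - δ / 2 := by linarith [hδ.2]
    obtain ⟨ν, hνst, hνint, -⟩ := hH δ hδ'
    have heq : μ (N + 1) (T + δ / 2) (T - δ / 2) = ν :=
      hU (N + 1) _ _ hL hR _ _ (hμ (N + 1) _ _ hL hR) hνst
    have hbal := h6 ω₂ lam β γ hω hl hβ hγ N (T + δ / 2) (T - δ / 2) hL hR ν hνst ⟨θ, hθ, hνint⟩
    show (N : ℝ) * γ * (((∫ z, (z.2 (Fin.last N)) ^ 2 ∂(μ (N + 1) (T + δ / 2) (T - δ / 2))) - T) / δ) +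
        (N : ℝ) * γ / 2 =
      (pinnedChain ω₂ lam β γ).totalCurrent (μ (N + 1) (T + δ / 2) (T - δ / 2)) / δ
    rw [heq, hbal]
    field_simp
    ring
  -- the limit of the left-hand side, and its value
  have hlim : Tendsto (fun δ : ℝ => (N : ℝ) * γ *
        (((∫ z, (z.2 (Fin.last N)) ^ 2 ∂(μ (N + 1) (T + δ / 2) (T - δ / 2))) - T) / δ) +
        (N : ℝ) * γ / 2) (𝓝[≠] (0 : ℝ))
      (𝓝 ((N : ℝ) * γ * (γ / (2 * T ^ 2) * (IY - IX)) + (N : ℝ) * γ / 2)) :=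
    (hresp.const_mul ((N : ℝ) * γ)).add tendsto_const_nhds
  have hval : (N : ℝ) * γ * (γ / (2 * T ^ 2) * (IY - IX)) + (N : ℝ) * γ / 2 =
      kuboValue ω₂ lam β γ T N := by
    have hIX' : IX = T ^ 2 / γ - IY := by linarith
    show _ = (N : ℝ) * (γ ^ 2 / T ^ 2) * IY
    rw [hIX']
    field_simp
    ring
  rw [hval] at hlim
  unfold LimitClause
  exact hlim.congr' hev

/-- **The crux, by name, from the registered stubs** (through the named statements). -/
theorem BoundaryKubo_of : Summit.AtomisticToContinuum.FouriersLaw.Theses.PhononMeanFreePath.BoundaryKubo :=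
  boundaryKubo_of_holds uniformHarris_holds momentumResponse_holds sumRule_holds energyBalance_holds

end Summit.AtomisticToContinuum.FouriersLaw.Cruxes.BoundaryKubo.GibbsTtcf

end
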